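import Literature.NumberTheory.LFunctions.JensenLaguerreSkeleton
import Literature.NumberTheory.LFunctions.JensenShiftCertificate
import Literature.NumberTheory.LFunctions.XiGaussWeight
import Literature.Analysis.SpecialFunctions.LaguerreSoninEnvelope
import HarnessLib

/-!
# The Jensen polynomials of `ξ` as Laguerre averages over the tilted Pólya–de Bruijn kernel

With `γ = xiTaylorCoeff` (GORZ 2019 eq. (1)), `M_k = ∫₀^∞ Φ(u) uᵏ du` (`xiMoment`) and the
Laguerre skeleton of `JensenLaguerreSkeleton.lean` (`γ(k) = 64 M_{2k}/(1/2)_k`,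
`J^{d,n}_{c/(b)_k} = (c d!/(b)_{n+d}) L_d^{(b+n-1)}(-X)`), the shift-`n`, degree-`d` Jensen polynomial of
`ξ` is an AVERAGE of the Laguerre polynomial `L_d^{(n-1/2)}` against the tilted kernel `u^{2n}Φ(u)`:

  `J^{d,n}_γ(X) = (64 d!/(1/2)_{n+d}) ∫₀^∞ Φ(u) u^{2n} L_d^{(n-1/2)}(-X u²) du`
  (`eval_jensenPoly_xiTaylorCoeff_eq_integral`),

and, for `x > 0`, in terms of the Szegő normal form `w(t) = e^{-t²/2} tⁿ L_d^{(n-1/2)}(t²)`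
(`laguerreNormal`, `LaguerreSoninEnvelope.lean`) and the GAUSS-TILTED weight `Φ(u) uⁿ e^{xu²/2}`:

  `(√x)ⁿ · J^{d,n}_γ(-x) = (64 d!/(1/2)_{n+d}) ∫₀^∞ Φ(u) uⁿ e^{xu²/2} w(√x·u) du`
  (`sqrt_pow_mul_eval_jensenPoly_xiTaylorCoeff_neg`).

So the sign of `J^{d,n}_γ(-x)` is the sign of the average of the bounded oscillatory function
`u ↦ w(√x u)` under the probability law `∝ Φ(u) uⁿ e^{xu²/2} du` — the starting point of the
all-degree hyperbolicity threshold (`JensenXiExponentialRange.lean`). Exact identities only (Fubini for a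
finite sum); the integrability of the Gauss-tilted weight comes from the tree's dominating function
`deBruijnHBound` of de Bruijn's `H_t`.

## References
* [GORZPNAS2019] Griffin–Ono–Rolen–Zagier, PNAS 116 (2019), eq. (1)–(2), Thm. 7 (the moments of `Φ`).
* [DimitrovBencheikh2009] Dimitrov–Ben Cheikh, J. Comput. Appl. Math. 233 (2009), §3 (Laguerre
  polynomials as Jensen polynomials of the Gamma sequence).
* [Szego1975] G. Szegő, *Orthogonal Polynomials*, (5.1.2) (the normal form).
-/

noncomputable section

open Polynomial Finset MeasureTheory Set
open scoped Nat

namespace Literature.NumberTheory.LFunctions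

open Literature.Analysis.SpecialFunctions (laguerre laguerreNormal ascPochhammer_eval_pos)

/-! ### `J^{d,n}_γ(X)` as a Laguerre average -/

/-- The Laguerre skeleton evaluated at a point: `Σ_{j ≤ d} (d choose j) (64/(1/2)_{n+j}) zʲ =
(64 d!/(1/2)_{n+d}) L_d^{(n-1/2)}(-z)`. [cite: DimitrovBencheikh2009, §3] -/
theorem sum_choose_div_ascPochhammer_mul_pow (d n : ℕ) (z : ℝ) :
    ∑ j ∈ range (d + 1), (d.choose j : ℝ) * (64 / (ascPochhammer ℝ (n + j)).eval (1 / 2 : ℝ)) * z ^ j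
      = 64 * (d ! : ℝ) / (ascPochhammer ℝ (n + d)).eval (1 / 2 : ℝ) *
          (laguerre ((n : ℝ) - 1 / 2) d).eval (-z) := by
  have h := jensenPoly_pochhammerInv (by norm_num : (0 : ℝ) < 1 / 2) 64 d n
  have he := congrArg (fun p => p.eval z) h
  simp only [eval_jensenPoly, eval_mul, eval_C, eval_comp, eval_neg, eval_X] at he
  rw [he]
  congr 1
  ring_nf

/-- **`J^{d,n}_γ(X) = (64 d!/(1/2)_{n+d}) ∫₀^∞ Φ(u) u^{2n} L_d^{(n-1/2)}(-X u²) du`** for the Taylor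
coefficients `γ = xiTaylorCoeff` of `ξ`: the Jensen polynomial is the tilted average of the Laguerre
polynomial with parameter `α = n - 1/2` (Laguerre skeleton + `γ(k)(1/2)_k = 64 M_{2k}` + Fubini for a
finite sum). [cite: GORZPNAS2019, Thm. 7] -/
theorem eval_jensenPoly_xiTaylorCoeff_eq_integral (d n : ℕ) (X : ℝ) :
    (jensenPoly xiTaylorCoeff d n).eval X =
      64 * (d ! : ℝ) / (ascPochhammer ℝ (n + d)).eval (1 / 2 : ℝ) *
        ∫ u in Ioi 0, deBruijnPhi u * u ^ (2 * n) * (laguerre ((n : ℝ) - 1 / 2) d).eval (-(X * u ^ 2)) := by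
  rw [jensenPoly_xiTaylorCoeff_eq_moment_skeleton, eval_jensenPoly]
  -- each summand as an integral
  have hterm : ∀ j ∈ range (d + 1),
      (d.choose j : ℝ) * (64 * xiMoment (2 * (n + j)) / (ascPochhammer ℝ (n + j)).eval (1 / 2 : ℝ)) * X ^ j
        = ∫ u in Ioi 0, (d.choose j : ℝ) * (64 / (ascPochhammer ℝ (n + j)).eval (1 / 2 : ℝ)) * X ^ j *
            (deBruijnPhi u * u ^ (2 * n) * u ^ (2 * j)) := by
    intro j _
    rw [integral_const_mul, xiMoment]
    have : (fun u : ℝ => deBruijnPhi u * u ^ (2 * n) * u ^ (2 * j)) =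
        fun u => deBruijnPhi u * u ^ (2 * (n + j)) := by
      funext u; rw [mul_add, pow_add]; ring
    rw [this]; ring
  rw [Finset.sum_congr rfl hterm, ← integral_finsetSum]
  · rw [← integral_const_mul]
    refine setIntegral_congr_fun measurableSet_Ioi fun u _ => ?_
    have hsum := sum_choose_div_ascPochhammer_mul_pow d n (X * u ^ 2)
    calc ∑ j ∈ range (d + 1), (d.choose j : ℝ) * (64 / (ascPochhammer ℝ (n + j)).eval (1 / 2 : ℝ))
          * X ^ j * (deBruijnPhi u * u ^ (2 * n) * u ^ (2 * j))
        = deBruijnPhi u * u ^ (2 * n) * ∑ j ∈ range (d + 1), (d.choose j : ℝ) *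
            (64 / (ascPochhammer ℝ (n + j)).eval (1 / 2 : ℝ)) * (X * u ^ 2) ^ j := by
          rw [Finset.mul_sum]
          refine Finset.sum_congr rfl fun j _ => ?_
          rw [mul_pow, pow_mul]; ring
      _ = _ := by rw [hsum]; ring
  · intro j _
    have h : IntegrableOn (fun u => (d.choose j : ℝ) * (64 / (ascPochhammer ℝ (n + j)).eval (1 / 2 : ℝ))
        * X ^ j * (deBruijnPhi u * u ^ (2 * (n + j)))) (Ioi 0) :=
      (integrableOn_deBruijnPhi_mul_pow (2 * (n + j))).const_mul
        ((d.choose j : ℝ) * (64 / (ascPochhammer ℝ (n + j)).eval (1 / 2 : ℝ)) * X ^ j)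
    refine h.congr_fun (fun u _ => ?_) measurableSet_Ioi
    simp only [mul_add, pow_add]
    ring

/-- The leading constant `64 d!/(1/2)_{n+d}` is positive. [cite: DimitrovBencheikh2009, §3] -/
theorem jensenXi_laguerreConst_pos (d n : ℕ) :
    0 < 64 * (d ! : ℝ) / (ascPochhammer ℝ (n + d)).eval (1 / 2 : ℝ) := by
  have h1 : 0 < (ascPochhammer ℝ (n + d)).eval (1 / 2 : ℝ) := ascPochhammer_eval_pos (by norm_num) _
  positivity

/-! ### The normal-form substitution for `X = -x`, `x > 0` -/

/-- Pointwise: `(√x)ⁿ · Φ(u) u^{2n} L(xu²) = Φ(u) uⁿ e^{xu²/2} · w(√x u)` (`u > 0`... in fact any `u`),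
where `w(t) = e^{-t²/2} tⁿ L(t²)` and `(√x u)² = x u²`. [cite: Szego1975, (5.1.2)] -/
theorem sqrt_pow_mul_phi_laguerre_eq (d n : ℕ) {x : ℝ} (hx : 0 ≤ x) (u : ℝ) :
    Real.sqrt x ^ n * (deBruijnPhi u * u ^ (2 * n) * (laguerre ((n : ℝ) - 1 / 2) d).eval (x * u ^ 2))
      = xiGaussWeight n x u * laguerreNormal n d (Real.sqrt x * u) := by
  have hsq : (Real.sqrt x * u) ^ 2 = x * u ^ 2 := by rw [mul_pow, Real.sq_sqrt hx]
  rw [xiGaussWeight, laguerreNormal, hsq]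
  have he : Real.exp (x * u ^ 2 / 2) * Real.exp (-(x * u ^ 2 / 2)) = 1 := by
    rw [← Real.exp_add, add_neg_cancel, Real.exp_zero]
  calc Real.sqrt x ^ n * (deBruijnPhi u * u ^ (2 * n) * (laguerre ((n : ℝ) - 1 / 2) d).eval (x * u ^ 2))
      = deBruijnPhi u * u ^ n * 1 * ((Real.sqrt x * u) ^ n *
          (laguerre ((n : ℝ) - 1 / 2) d).eval (x * u ^ 2)) := by
        rw [mul_pow, pow_mul, ← hsq]; ring
    _ = _ := by rw [← he]; ring

/-- **Normal-form representation**: for `x ≥ 0`,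
`(√x)ⁿ · J^{d,n}_γ(-x) = (64 d!/(1/2)_{n+d}) ∫₀^∞ Φ(u) uⁿ e^{xu²/2} w(√x u) du`. Hence `J^{d,n}_γ(-x)` has
the sign of the average of `w(√x ·)` under the Gauss-tilted law. [cite: GORZPNAS2019, Thm. 7] -/
theorem sqrt_pow_mul_eval_jensenPoly_xiTaylorCoeff_neg (d n : ℕ) {x : ℝ} (hx : 0 ≤ x) :
    Real.sqrt x ^ n * (jensenPoly xiTaylorCoeff d n).eval (-x) =
      64 * (d ! : ℝ) / (ascPochhammer ℝ (n + d)).eval (1 / 2 : ℝ) *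
        ∫ u in Ioi 0, xiGaussWeight n x u * laguerreNormal n d (Real.sqrt x * u) := by
  rw [eval_jensenPoly_xiTaylorCoeff_eq_integral, mul_left_comm, ← integral_const_mul]
  congr 1
  refine setIntegral_congr_fun measurableSet_Ioi fun u _ => ?_
  rw [show -(-x * u ^ 2) = x * u ^ 2 by ring]
  exact sqrt_pow_mul_phi_laguerre_eq d n hx u

/-- **Sign transfer**: for `x > 0`, if `(-1)^j ∫₀^∞ ω_{n,x}(u) w(√x u) du > 0` then
`(-1)^j J^{d,n}_γ(-x) > 0`. [cite: GORZPNAS2019, Thm. 7] -/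
theorem sign_eval_jensenPoly_xiTaylorCoeff_neg (d n : ℕ) {x : ℝ} (hx : 0 < x) (j : ℕ)
    (h : 0 < (-1) ^ j * ∫ u in Ioi 0, xiGaussWeight n x u * laguerreNormal n d (Real.sqrt x * u)) :
    0 < (-1) ^ j * (jensenPoly xiTaylorCoeff d n).eval (-x) := by
  have hc := jensenXi_laguerreConst_pos d n
  have hs : 0 < Real.sqrt x ^ n := pow_pos (Real.sqrt_pos.2 hx) n
  have key := sqrt_pow_mul_eval_jensenPoly_xiTaylorCoeff_neg d n hx.le
  have : 0 < Real.sqrt x ^ n * ((-1) ^ j * (jensenPoly xiTaylorCoeff d n).eval (-x)) := by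
    rw [mul_left_comm, key, ← mul_assoc, mul_comm ((-1 : ℝ) ^ j), mul_assoc]
    exact mul_pos hc h
  exact (mul_pos_iff_of_pos_left hs).1 this

end Literature.NumberTheory.LFunctions
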